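import Summits.HodgeConjecture.HodgeConjecture.Theorems.Ring2WeilCoverageCMUnitSignature
import Literature.AlgebraicGeometry.ComplexMultiplication.CyclotomicCMTypeResidues
import Mathlib.NumberTheory.Cyclotomic.Gal
import Mathlib.NumberTheory.NumberField.Cyclotomic.Basic
import Mathlib.Algebra.CharP.Lemmas
import HarnessLib

/-!
# Weil-type family coverage — THEOREM L (i) BY REDUCTION MODULO A RAMIFIED PRIME: if `K = ℚ(ζₙ)`, `q ∣ n` is a prime and
# the norm product `∏_{t ∈ T} σ_t` of a real unit, read in a characteristic-`q` ring through `ζ ↦ r`, collapses by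
# Frobenius to a power `y^E` with `y^E = 1`, then NO unit of `ℚ(ζₙ)⁺` has norm `−1`

research route conditional on HC_CM; not a corollary; Q11.4-sentence-2 already refuted in dim ≥ 3.

Ring 2, WEIL-TYPE FAMILY-COVERAGE CENSUS (`HOME/WEIL-FAMILY-COVERAGE.md` `## b01`, block b01.28 THEOREM L (i) «no unit of
`ℚ(ζ_M)⁺` has norm `−1` for `M` not a prime power»; owner ring2-b01), part 62 of the `Ring2WeilCoverage*` series.  THEOREM
L (i) is the obstruction input of the census's polarisation criteria (parts 2, 7, 48, 53, 55); it is a tree theorem at the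
levels whose maximal real subfield contains `√D` with a prime `q ≡ 3 (mod 4)`, `q ∥ D` (parts 8/9/10: `21, 28, 36, 33,
44`; part 57: every `12 ∣ M`), and at `35, 45` (part 31, cyclic quartic units).  The levels `40` (`ℚ(ζ₄₀)⁺ ⊇ ℚ(√2), ℚ(√5), ℚ(√10)`,
all with units of norm `−1`) and `52` (`ℚ(ζ₅₂)⁺ ⊇ ℚ(√13)`) have no such quadratic subfield.  This file proves THEOREM L (i)
by a different, uniform, elementary device — REDUCTION MODULO A PRIME `q ∣ n`:

Let `u` be a unit of `𝓞 K⁺` with `N_{K⁺/ℚ}(u) = −1`, `U` its image in `𝓞 K = ℤ[ζ]`, `T ⊆ (ℤ/n)ˣ` a CM type set and `Φ`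
the CM type reading `T`.  By part 2 (`prod_embedding_algebraMap_eq_norm`) `∏_{φ ∈ Φ} φ(U) = −1`; the embedding reading `t`
is `φ₁ ∘ σ_t` (`σ_t : ζ ↦ ζ^t` the Galois automorphism), so `∏_{t ∈ T} σ_t(U) = −1` in `𝓞 K` (§2
`prod_aut_eq_neg_one_of_norm_eq_neg_one`).  Now let `R` be a commutative ring of prime characteristic `q` and `r ∈ R` a
root of the `n`-th cyclotomic polynomial (when `n = q^b·n₀`, `q ∤ n₀`: a primitive `n₀`-th root of unity — the
`q`-power roots of unity die in characteristic `q`), and `ψ : 𝓞 K = ℤ[ζ] → R`, `ζ ↦ r` (§1, Mathlib's integral power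
basis).  If for each `t ∈ T` either `t ≡ q^{e_t}` or `−t ≡ q^{e_t}` modulo the order `n₀` of `r`, then
`ψ ∘ σ_t = Frob^{e_t} ∘ ψ` resp. `ψ ∘ σ_t ∘ ρ = Frob^{e_t} ∘ ψ` on `ℤ[ζ]` (ring maps agreeing on `ζ`), so
`ψ(σ_t U) = y^{q^{e_t}}` with `y = ψ(U)` (`U` is real), and `−1 = ψ(−1) = ∏_t y^{q^{e_t}} = y^E`, `E = Σ_t q^{e_t}`.  If
`y^E = 1` for every unit `y` of `R` (e.g. `|Rˣ| ∣ E`) this forces `−1 = 1` in `R`, impossible for `q` odd: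

* §1 `exists_aut_apply_eq_pow` (`σ_t`), `toCircle_one_pow` (`𝐞(1)^t = 𝐞(t)`), `prod_embedding_eq_prod_aut` (the
  `Φ`-product of any `x ∈ K` is `φ₁(∏_{t∈T} σ_t x)`);
* §2 `prod_aut_eq_neg_one_of_norm_eq_neg_one`;
* §3 **`norm_realUnits_pos_of_reduction`** — THEOREM L (i) for `K` from the data `(R, q, r, n₀, T, e)` with the two
  decidable congruence conditions and the kill condition `∀ y ∈ Rˣ, y^E = 1`.

Part 63 instantiates it at `n = 40` (`q = 5`, `R = 𝔽₂₅`, `r` of order `8`, `E = 24`) and `n = 52` (`q = 13`,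
`R = 𝔽₁₃`, `r = 5` of order `4`, `E = 12`): THEOREM L (i) at the last two one-sided census levels, so that the norm-sign
law (parts 55/56) is two-sided at EVERY census level except `32` (where it provably fails, part 61).  The same data exist at
every non-prime-power census level (`21: q = 7`; `28, 44, 52: n = 4q`; `35: q = 7, 𝔽₇⁴`; …) — a uniform proof of THEOREM
L (i) without class field theory; not needed there and not filed.

HONEST FRAMING: elementary algebraic number theory (`𝓞 ℚ(ζₙ) = ℤ[ζₙ]`, Galois automorphisms of `ℚ(ζₙ)`, Frobenius in
characteristic `q`); nothing here is a statement about Hodge classes, `W_K`, general members or HC; `HC_CM` is used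
nowhere.  No `def`, no named fact, no `sorry`.

References: [cite: Washington1997, §2, Prop. 2.16 and Thm. 2.6]; census b01.28 THEOREM L (i) (seat-derived proof).
-/

noncomputable section

open scoped Classical nonZeroDivisors NumberField ComplexConjugate
open NumberField NumberField.ComplexEmbedding Module Complex Polynomial Finset

namespace Summit.HodgeConjecture.Ring2WeilCoverage.RealUnitNormReduction

open Literature.AlgebraicGeometry.Motives (CMType)
open Literature.AlgebraicGeometry.HodgeTheory (IsCMTypeSet)
open Literature.AlgebraicGeometry.ComplexMultiplication.CyclotomicCMType
  (exists_apply_eq_toCircle embedding_eq_of_apply_eq exists_embedding_apply_eq_toCircle exists_cmType_iff_mem)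
open Summit.HodgeConjecture.Ring2WeilCoverage.CMUnitSignature (prod_embedding_algebraMap_eq_norm)

variable {K : Type} [Field K] [NumberField K] {n : ℕ} [NeZero n] {ζ : K}

/-- `𝐞(t) = exp(2πi t/n) ∈ ℂ` (`ZMod.toCircle`). -/
local notation3 (prettyPrint := false) "𝐞 " t:max => ((ZMod.toCircle t : Circle) : ℂ)

/-! ### §1 Galois automorphisms `σ_t : ζ ↦ ζ^t` and the `Φ`-product as `φ₁(∏_t σ_t x)` -/

/-- **`σ_t : ζ ↦ ζ^t`**: for every unit residue `t` mod `n` there is a `ℚ`-automorphism of `K = ℚ(ζₙ)` with `σ ζ = ζ^t`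
(Mathlib `IsCyclotomicExtension.fromZetaAut` on the primitive root `ζ₀^t`, `ζ₀ = zeta`; `ζ` is a power of `ζ₀`).
research route conditional on HC_CM; not a corollary; Q11.4-sentence-2 already refuted in dim ≥ 3. [cite: Washington1997, §2, Thm. 2.5] -/
theorem exists_aut_apply_eq_pow [IsCyclotomicExtension {n} ℚ K] (hζ : IsPrimitiveRoot ζ n) (t : ZMod n)
    (ht : t.val.Coprime n) : ∃ σ : K ≃ₐ[ℚ] K, σ ζ = ζ ^ t.val := by
  have hirr : Irreducible (cyclotomic n ℚ) := cyclotomic.irreducible_rat (NeZero.pos n)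
  have hz := IsCyclotomicExtension.zeta_spec n ℚ K
  have hμ : IsPrimitiveRoot (IsCyclotomicExtension.zeta n ℚ K ^ t.val) n := hz.pow_of_coprime t.val ht
  refine ⟨IsCyclotomicExtension.fromZetaAut hμ hirr, ?_⟩
  have hspec := IsCyclotomicExtension.fromZetaAut_spec hμ hirr
  obtain ⟨a, -, ha⟩ := hz.eq_pow_of_pow_eq_one hζ.pow_eq_one
  rw [← ha, map_pow, hspec, ← pow_mul, ← pow_mul, mul_comm]

omit [NumberField K] in
/-- `𝐞(1)^t = 𝐞(t)` (`ZMod.toCircle` is an additive character).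
research route conditional on HC_CM; not a corollary; Q11.4-sentence-2 already refuted in dim ≥ 3. [folklore] -/
theorem toCircle_one_pow (t : ZMod n) : (𝐞 (1 : ZMod n)) ^ t.val = 𝐞 t := by
  rw [← Circle.coe_pow, ← AddChar.map_nsmul_eq_pow, nsmul_eq_mul, mul_one, ZMod.natCast_zmod_val]

/-- **The `Φ`-product is `φ₁` of the automorphism product**: if the CM type `Φ` reads the CM type set `T`, `φ₁` is the
embedding `ζ ↦ 𝐞(1)` and `σ_t ζ = ζ^t` for the unit residues `t`, then for every `x ∈ K`:
`∏_{φ ∈ Φ} φ(x) = φ₁(∏_{t ∈ T} σ_t(x))` — the member of `Φ` reading `t` is `φ₁ ∘ σ_t`.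
research route conditional on HC_CM; not a corollary; Q11.4-sentence-2 already refuted in dim ≥ 3. [folklore] -/
theorem prod_embedding_eq_prod_aut [IsCyclotomicExtension {n} ℚ K] (hζ : IsPrimitiveRoot ζ n) {T : Finset (ZMod n)}
    (hT : IsCMTypeSet n T) {Φ : CMType K} (hΦ : ∀ σ : K →+* ℂ, σ ∈ Φ.1 ↔ ∃ t ∈ T, σ ζ = 𝐞 t) {φ₁ : K →+* ℂ}
    (hφ₁ : φ₁ ζ = 𝐞 (1 : ZMod n)) {σf : ZMod n → (K ≃ₐ[ℚ] K)}
    (hσf : ∀ t : ZMod n, t.val.Coprime n → σf t ζ = ζ ^ t.val)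
    (x : K) : ∏ φ : Φ.1, φ.1 x = φ₁ (∏ t ∈ T, σf t x) := by
  -- the embedding `φ₁ ∘ σ_t` reads `t`
  have hread : ∀ t : ZMod n, t.val.Coprime n → (φ₁.comp (σf t).toRingEquiv.toRingHom) ζ = 𝐞 t := by
    intro t ht
    change φ₁ (σf t ζ) = 𝐞 t
    rw [hσf t ht, map_pow, hφ₁, toCircle_one_pow]
  -- the bijection `T → Φ`, `t ↦ φ₁ ∘ σ_t`
  set g : {t : ZMod n // t ∈ T} → Φ.1 := fun t =>
    ⟨φ₁.comp (σf t).toRingEquiv.toRingHom, (hΦ _).mpr ⟨t.1, t.2, hread t.1 (hT.1 t.1 t.2)⟩⟩ with hg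
  have hbij : Function.Bijective g := by
    constructor
    · intro t t' h
      have h1 : (φ₁.comp (σf t).toRingEquiv.toRingHom) ζ = (φ₁.comp (σf t').toRingEquiv.toRingHom) ζ := by
        have := congrArg (fun φ : Φ.1 => φ.1 ζ) h
        exact this
      rw [hread t.1 (hT.1 t.1 t.2), hread t'.1 (hT.1 t'.1 t'.2)] at h1
      exact Subtype.ext (ZMod.injective_toCircle (Circle.ext h1))
    · intro φ
      obtain ⟨t, ht, hφt⟩ := (hΦ φ.1).mp φ.2
      refine ⟨⟨t, ht⟩, Subtype.ext ?_⟩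
      exact embedding_eq_of_apply_eq hζ ((hread t (hT.1 t ht)).trans hφt.symm)
  rw [map_prod, ← Finset.prod_coe_sort T]
  symm
  exact Fintype.prod_bijective g hbij (fun t : {t : ZMod n // t ∈ T} => φ₁ (σf t x)) (fun φ : Φ.1 => φ.1 x)
    (fun t => rfl)

/-! ### §2 A real unit of norm `−1` has automorphism product `−1` -/

omit [NumberField K] [NeZero n] in
/-- The image in `K` of an integer of `K⁺` pushed into `𝓞 K` is its image under `K⁺ ⊂ K`.
research route conditional on HC_CM; not a corollary; Q11.4-sentence-2 already refuted in dim ≥ 3. [folklore] -/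
theorem coe_algebraMap_realIntegers (u : 𝓞 (maximalRealSubfield K)) :
    ((algebraMap (𝓞 (maximalRealSubfield K)) (𝓞 K) u : 𝓞 K) : K) =
      algebraMap (maximalRealSubfield K) K (u : maximalRealSubfield K) := by
  rw [RingOfIntegers.coe_eq_algebraMap, ← IsScalarTower.algebraMap_apply (𝓞 (maximalRealSubfield K)) (𝓞 K) K,
    IsScalarTower.algebraMap_apply (𝓞 (maximalRealSubfield K)) (maximalRealSubfield K) K,
    ← RingOfIntegers.coe_eq_algebraMap]

/-- **`N_{K⁺/ℚ}(u) = −1` ⟹ `∏_{t ∈ T} σ_t(U) = −1` in `𝓞 K`** for the image `U` of `u` in `𝓞 K` and any CM type set `T`: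
part 2's `∏_{φ∈Φ} φ(U) = N_{K⁺/ℚ}(u)` for the CM type `Φ` reading `T`, §1, and injectivity of `φ₁`.
research route conditional on HC_CM; not a corollary; Q11.4-sentence-2 already refuted in dim ≥ 3. [folklore] -/
theorem prod_aut_eq_neg_one_of_norm_eq_neg_one [IsCMField K] [IsCyclotomicExtension {n} ℚ K]
    (hζ : IsPrimitiveRoot ζ n) {T : Finset (ZMod n)} (hT : IsCMTypeSet n T) {σf : ZMod n → (K ≃ₐ[ℚ] K)}
    (hσf : ∀ t : ZMod n, t.val.Coprime n → σf t ζ = ζ ^ t.val) {u : 𝓞 (maximalRealSubfield K)}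
    (hu : Algebra.norm ℚ ((u : maximalRealSubfield K)) = -1) :
    ∏ t ∈ T, RingOfIntegers.mapRingHom (σf t).toRingEquiv.toRingHom
        (algebraMap (𝓞 (maximalRealSubfield K)) (𝓞 K) u) = -1 := by
  obtain ⟨Φ, hΦ⟩ := exists_cmType_iff_mem (K := K) hζ hT
  have h1 : (1 : ZMod n).val.Coprime n := by
    rw [ZMod.val_one_eq_one_mod]
    rcases Nat.lt_or_ge 1 n with hn | hn
    · rw [Nat.mod_eq_of_lt hn]; exact Nat.coprime_one_left n
    · have : n = 1 := le_antisymm hn (NeZero.pos n)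
      subst this; simp
  obtain ⟨φ₁, hφ₁⟩ := exists_embedding_apply_eq_toCircle hζ 1 h1
  set U : 𝓞 K := algebraMap (𝓞 (maximalRealSubfield K)) (𝓞 K) u with hU
  have hUK : (U : K) = algebraMap (maximalRealSubfield K) K (u : maximalRealSubfield K) := by
    rw [hU]; exact coe_algebraMap_realIntegers u
  -- `φ₁ (∏_t σ_t U) = N(u) = -1`
  have hprod := prod_embedding_algebraMap_eq_norm Φ (u : maximalRealSubfield K)
  rw [← hUK, prod_embedding_eq_prod_aut hζ hT hΦ hφ₁ hσf (U : K), hu, map_neg, map_one] at hprod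
  have hK : ∏ t ∈ T, σf t (U : K) = -1 := φ₁.injective (by rw [hprod, map_neg, map_one])
  apply FaithfulSMul.algebraMap_injective (𝓞 K) K
  rw [map_prod, map_neg, map_one]
  refine (Finset.prod_congr rfl fun t _ => ?_).trans hK
  rw [← RingOfIntegers.coe_eq_algebraMap, RingOfIntegers.mapRingHom_apply]
  rfl

/-! ### §3 THEOREM L (i) by reduction modulo `q` -/

/-- **THEOREM L (i) BY REDUCTION MODULO A PRIME.**  Let `K = ℚ(ζₙ)` be a CM cyclotomic field with primitive root `ζ`, `R`
a commutative ring of prime characteristic `q` with `2 ≠ 0` in `R`, and `r ∈ R` a root of the `n`-th cyclotomic polynomial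
with `r^{n₀} = 1`.  Let `T` be a CM type set of unit residues mod `n` and `e : ℤ/n → ℕ` exponents such that for each
`t ∈ T` either `t ≡ q^{e t}` or `(n−1)·t ≡ q^{e t}` modulo `n₀` (decidable), and suppose every unit `y` of `R` satisfies
`y^E = 1`, `E = Σ_{t∈T} q^{e t}`.  THEN EVERY UNIT OF `𝓞 K⁺` HAS POSITIVE NORM.  Proof: a unit `u` of norm `−1` gives
`∏_{t∈T} σ_t(U) = −1` in `ℤ[ζ]` (§2); the ring map `ψ : ℤ[ζ] → R`, `ζ ↦ r` (integral power basis) has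
`ψ ∘ σ_t = Frob^{e t} ∘ ψ` (or `∘ ρ`, and `U^ρ = U`) by the congruences, so `ψ(σ_t U) = ψ(U)^{q^{e t}}` and
`−1 = ψ(U)^E = 1` in `R`, i.e. `2 = 0`.
research route conditional on HC_CM; not a corollary; Q11.4-sentence-2 already refuted in dim ≥ 3. [cite: Washington1997, §2, Prop. 2.16] -/
theorem norm_realUnits_pos_of_reduction [IsCMField K] [IsCyclotomicExtension {n} ℚ K] (hζ : IsPrimitiveRoot ζ n)
    {R : Type*} [CommRing R] {q : ℕ} [Fact q.Prime] [CharP R q] (h2 : (2 : R) ≠ 0) {r : R}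
    (hr : aeval r (cyclotomic n ℤ) = 0) {n₀ : ℕ} (hn₀ : r ^ n₀ = 1) {T : Finset (ZMod n)} (hT : IsCMTypeSet n T)
    (e : ZMod n → ℕ)
    (hcong : ∀ t ∈ T, t.val % n₀ = q ^ (e t) % n₀ ∨ ((n - 1) * t.val) % n₀ = q ^ (e t) % n₀)
    (hkill : ∀ y : Rˣ, (y : R) ^ (∑ t ∈ T, q ^ (e t)) = 1) (v : (𝓞 (maximalRealSubfield K))ˣ) :
    0 < Algebra.norm ℚ (((v : 𝓞 (maximalRealSubfield K)) : maximalRealSubfield K)) := by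
  -- the norm of a unit is `±1`
  have hvZ : IsUnit (Algebra.norm ℤ (v : 𝓞 (maximalRealSubfield K))) := v.isUnit.map _
  have hnormQ : Algebra.norm ℚ (((v : 𝓞 (maximalRealSubfield K)) : maximalRealSubfield K)) =
      ((Algebra.norm ℤ (v : 𝓞 (maximalRealSubfield K)) : ℤ) : ℚ) :=
    (Algebra.coe_norm_int _).symm
  rcases Int.isUnit_iff.mp hvZ with h1 | hneg1
  · rw [hnormQ, h1]; norm_num
  exfalso
  have hu : Algebra.norm ℚ (((v : 𝓞 (maximalRealSubfield K)) : maximalRealSubfield K)) = -1 := by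
    rw [hnormQ, hneg1]; norm_num
  -- automorphisms `σ_t`
  have hσ : ∀ t : ZMod n, ∃ σ : K ≃ₐ[ℚ] K, t.val.Coprime n → σ ζ = ζ ^ t.val := fun t => by
    by_cases ht : t.val.Coprime n
    · obtain ⟨σ, hσ⟩ := exists_aut_apply_eq_pow hζ t ht
      exact ⟨σ, fun _ => hσ⟩
    · exact ⟨AlgEquiv.refl, fun h => absurd h ht⟩
  choose σf hσf using hσ
  -- the integral product is `-1`
  set U : 𝓞 K := algebraMap (𝓞 (maximalRealSubfield K)) (𝓞 K) (v : 𝓞 (maximalRealSubfield K)) with hUdef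
  have hP := prod_aut_eq_neg_one_of_norm_eq_neg_one hζ hT hσf hu
  rw [← hUdef] at hP
  -- `U` is real and a unit
  have hUreal : IsCMField.complexConj K (U : K) = U := by
    rw [hUdef, coe_algebraMap_realIntegers]
    exact IsCMField.complexConj_apply_eq_self K _
  have hUunit : IsUnit U := v.isUnit.map _
  -- the reduction map `ψ : 𝓞 K → R`, `ζ ↦ r`
  set pb := hζ.integralPowerBasis with hpb
  have hgen : pb.gen = hζ.toInteger := hζ.integralPowerBasis_gen
  have hmin : minpoly ℤ pb.gen = cyclotomic n ℤ := by
    rw [hgen, ← minpoly.algebraMap_eq (FaithfulSMul.algebraMap_injective (𝓞 K) K) hζ.toInteger,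
      show algebraMap (𝓞 K) K hζ.toInteger = ζ from rfl, ← cyclotomic_eq_minpoly hζ (NeZero.pos n)]
  have hr' : aeval r (minpoly ℤ pb.gen) = 0 := by rw [hmin]; exact hr
  set ψ : 𝓞 K →ₐ[ℤ] R := pb.lift r hr' with hψ
  have hψζ : ψ hζ.toInteger = r := by rw [← hgen]; exact pb.lift_gen r hr'
  -- powers of `r` reduce modulo `n₀`
  have hred : ∀ a : ℕ, r ^ a = r ^ (a % n₀) := fun a => pow_eq_pow_mod a hn₀
  -- complex conjugation on `𝓞 K` sends `ζ` to `ζ^(n-1)`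
  set c : 𝓞 K →+* 𝓞 K := RingOfIntegers.mapRingHom (IsCMField.complexConj K).toRingEquiv.toRingHom with hc
  have hcU : c U = U := RingOfIntegers.ext (by rw [hc, RingOfIntegers.mapRingHom_apply]; exact hUreal)
  have hζinv : IsCMField.complexConj K ζ = ζ ^ (n - 1) := by
    obtain ⟨φ⟩ := (inferInstance : Nonempty (K →+* ℂ))
    apply φ.injective
    rw [IsCMField.complexEmbedding_complexConj, map_pow]
    have hn1 : ‖φ ζ‖ = 1 := Complex.norm_eq_one_of_pow_eq_one (by rw [← map_pow, hζ.pow_eq_one, map_one])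
      (NeZero.ne n)
    rw [← Complex.inv_eq_conj hn1]
    apply inv_eq_of_mul_eq_one_right
    rw [← pow_succ', Nat.sub_add_cancel (Nat.one_le_iff_ne_zero.mpr (NeZero.ne n)), ← map_pow, hζ.pow_eq_one,
      map_one]
  have hcζ : c hζ.toInteger = hζ.toInteger ^ (n - 1) := RingOfIntegers.ext (by
    rw [hc, RingOfIntegers.mapRingHom_apply]
    push_cast
    exact hζinv)
  -- the key identity `ψ (σ_t U) = ψ(U) ^ q ^ (e t)` for `t ∈ T`
  have hkey : ∀ t ∈ T, ψ (RingOfIntegers.mapRingHom (σf t).toRingEquiv.toRingHom U) = ψ U ^ q ^ (e t) := by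
    intro t ht
    have htu : t.val.Coprime n := hT.1 t ht
    set s : 𝓞 K →+* 𝓞 K := RingOfIntegers.mapRingHom (σf t).toRingEquiv.toRingHom with hs
    have hsζ : s hζ.toInteger = hζ.toInteger ^ t.val := RingOfIntegers.ext (by
      rw [hs, RingOfIntegers.mapRingHom_apply]
      push_cast
      exact hσf t htu)
    rcases hcong t ht with hpos | hneg
    · -- `ψ ∘ σ_t = Frob^e ∘ ψ`
      have H : (ψ.toRingHom.comp s).toIntAlgHom = ((iterateFrobenius R q (e t)).comp ψ.toRingHom).toIntAlgHom := by
        apply pb.algHom_ext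
        change ψ (s pb.gen) = iterateFrobenius R q (e t) (ψ pb.gen)
        rw [hgen, hsζ, map_pow, hψζ, iterateFrobenius_def, hred t.val, hred (q ^ e t), hpos]
      have := congrArg (fun f : 𝓞 K →ₐ[ℤ] R => f U) H
      change ψ (s U) = iterateFrobenius R q (e t) (ψ U) at this
      rwa [iterateFrobenius_def] at this
    · -- `ψ ∘ σ_t ∘ ρ = Frob^e ∘ ψ`, and `U^ρ = U`
      have H : (ψ.toRingHom.comp (s.comp c)).toIntAlgHom =
          ((iterateFrobenius R q (e t)).comp ψ.toRingHom).toIntAlgHom := by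
        apply pb.algHom_ext
        change ψ (s (c pb.gen)) = iterateFrobenius R q (e t) (ψ pb.gen)
        rw [hgen, hcζ, map_pow, hsζ, ← pow_mul, map_pow, hψζ, iterateFrobenius_def, mul_comm,
          hred ((n - 1) * t.val), hred (q ^ e t), hneg]
      have := congrArg (fun f : 𝓞 K →ₐ[ℤ] R => f U) H
      change ψ (s (c U)) = iterateFrobenius R q (e t) (ψ U) at this
      rwa [hcU, iterateFrobenius_def] at this
  -- apply `ψ` to the product
  have hψP := congrArg ψ hP
  rw [map_prod, map_neg, map_one, Finset.prod_congr rfl hkey, Finset.prod_pow_eq_pow_sum] at hψP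
  obtain ⟨y, hy⟩ := hUunit.map ψ
  rw [← hy, hkill y] at hψP
  -- `1 = -1` in `R`
  apply h2
  linear_combination hψP

end Summit.HodgeConjecture.Ring2WeilCoverage.RealUnitNormReduction

end
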